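import Summits.BirchSwinnertonDyer.BirchSwinnertonDyer.Theorems.EisensteinPrimesResidualDevissageCount
import Summits.BirchSwinnertonDyer.BirchSwinnertonDyer.Theorems.UniversalToricDescentResidualSelmerExact
import HarnessLib

/-!
# The residual dévissage COUNTED (lower half and the elliptic-curve assembly): `#R(A) · #R(C) ≤ #R(B) · #C`
# modulo the surjectivity of `R(B) → R(C)`, and both counts along a `Γ_K`-stable `Φ ≤ E[p]` (cell `bsd-eis`,
# seat `bsd-line-x2-p2` gen 5, D-0154 KEY row 5; crux 4 `BSDpOnCellC` line b1; sequel of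
# `…ResidualDevissageCount`)

HONEST FRAMING (cell `bsd-eis`, run/shared/lean/pub/bsd-eis/): pure Galois-cohomology bookkeeping on constructed
objects (no definition, no named fact, no `sorry`, no `Theses` import); nothing about any curve is asserted;
nothing booked; no label or count moves; BSD and the main conjectures are proved for NO curve. Helper
`--supports stmt-BirchSwinnertonDyer-19034`; closes no registered stub.

`R(·) = R_𝔭^Σ(K_∞, ·) := GreenbergVatsal2000.datumStrictSelmer (ker κ) · p (AcSelmer.bdpData · p 𝔭) Σ` (Castella's
residual condition: strict at `𝔭`, relaxed at the other places above `p`, unramified outside `Σ`).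

* §4 `natCard_mul_natCard_le_of_surjective` — for a `Γ_K`-equivariant complex `A —j→ B —q→ C` (`j` injective,
  `ker q ⊆ im j`, `q ∘ j = 0`, `C` finite, `R(B)` finite): IF `q_* : R(B) → R(C)` is surjective THEN
  **`#R(A) · #R(C) ≤ #R(B) · #C`** (`j_* R(A) ⊆ ker(q_*|R(B))` and `#ker(j_*|R(A)) ≤ #C`, file 1 §1). No
  hypothesis at `𝔭`, no (U). The surjectivity is the residual shadow of the global-to-local surjectivity the
  printed proofs take from Pollack–Weston A.2 / Greenberg–Vatsal Prop. 2.1 — the ONE input this direction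
  (the direction crux 4's wall consumes: a LOWER bound for `λ(𝔛^S_f)`) still needs.
* §5 the assembly for `B = E[p]`, `A = Φ` a `Γ_K`-stable subgroup, `C = E[p]/Φ` (any reduction type at `p`, any
  `ℤ_p`-extension; (U) discharged by Néron–Ogg–Shafarevich at the good places outside `Σ`):
  `natCard_residualSelmer_torsion_le_of_stableSubgroup` **`#R(E[p]) ≤ #R(Φ) · #R(E[p]/Φ) · #(E[p]/Φ)^{p^c}`**
  (`p^c` representatives above `𝔭`; `exists_…` form from Brink's `D_𝔭 ⊄ ker κ`), and
  `natCard_mul_le_of_stableSubgroup_of_surjective` **`#R(Φ) · #R(E[p]/Φ) ≤ #R(E[p]) · #(E[p]/Φ)`** given the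
  surjectivity. For a rational line at an Eisenstein prime (`#(E[p]/Φ) = p`), in `𝔽_p`-dimensions:
  `d R(φ) + d R(ψ) − 1 ≤ d R(E[p]) ≤ d R(φ) + d R(ψ) + p^c` — Keller–Yin Thm. 1.4.1's `λ`-count in residual
  currency up to the local term, its `+1` being the `#(E[p]/Φ)` of §4.

References: [KellerYin2024] Thm. 1.4.1, Rem. 1.4.2, §5.1 (arXiv:2402.12781v2); [GreenbergVatsal2000] §2 Prop. (2.1),
pp. 25–26; [PollackWeston2011] App. A Prop. A.2; [CastellaGrossiLeeSkinner2022] Prop. 17 (arXiv:2008.02571 §1.4);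
[SilvermanAEC2009] Prop. VII.4.1(a), Cor. III.6.4; [Brink2007] Cor. 1; cell p628626 (g4).
-/

set_option autoImplicit false
set_option linter.dupNamespace false -- the summit namespace `…BirchSwinnertonDyer.BirchSwinnertonDyer.Theorems` (Sub = Summit, D-0017) trips it

noncomputable section

open scoped Classical

universe u

namespace Summit.BirchSwinnertonDyer.BirchSwinnertonDyer.Theorems.ResidualDevissageCountLower

open Literature.NumberTheory.EllipticCurves Literature.NumberTheory.EllipticCurves.GreenbergSelmer
  Literature.NumberTheory.EllipticCurves.GreenbergVatsal2000 Literature.NumberTheory.GaloisRepresentations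
  Literature.NumberTheory.EllipticCurves.FineSelmerCoefficientMap
  NumberField IsDedekindDomain Field WeierstrassCurve
  Summit.BirchSwinnertonDyer.Rank1Residual.X11b Summit.BirchSwinnertonDyer.Rank1Residual.X11b.AcSelmer
  Summit.BirchSwinnertonDyer.Rank1Residual.X2.ResidualDevissageModules
  Summit.BirchSwinnertonDyer.BirchSwinnertonDyer.Theorems.UniversalToricDescentResidualSelmer
  Summit.BirchSwinnertonDyer.BirchSwinnertonDyer.Theorems.UniversalToricDescentResidualSelmerFinite
  Summit.BirchSwinnertonDyer.BirchSwinnertonDyer.Theorems.CumulativeHeegnerInclusionAtThreeStubB1Devissage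
  Summit.BirchSwinnertonDyer.BirchSwinnertonDyer.Theorems.CumulativeHeegnerInclusionAtThreeStubB1DevissageNamed
  Summit.BirchSwinnertonDyer.BirchSwinnertonDyer.Theorems.CumulativeHeegnerInclusionAtThreeResidualDevissage
  Summit.BirchSwinnertonDyer.BirchSwinnertonDyer.Theorems.ResidualDevissageFiniteKernel
  Summit.BirchSwinnertonDyer.BirchSwinnertonDyer.Theorems.ResidualDevissageCount

/-! ### §4 LOWER count modulo the surjectivity of `q_* : R(B) → R(C)` -/

section Residual

variable {K : Type} [Field K] [NumberField K] {p : ℕ} [Fact p.Prime] (κ : ZpExtension K p)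
  (𝔭 : HeightOneSpectrum (𝓞 K)) (S₀ : Set (HeightOneSpectrum (𝓞 K)))

variable {A : Type} [AddCommGroup A] [DistribMulAction (absoluteGaloisGroup K) A] [TopologicalSpace A]
  [DiscreteTopology A]
variable {B : Type} [AddCommGroup B] [DistribMulAction (absoluteGaloisGroup K) B] [TopologicalSpace B]
  [DiscreteTopology B]
variable {C : Type} [AddCommGroup C] [DistribMulAction (absoluteGaloisGroup K) C] [TopologicalSpace C]
  [DiscreteTopology C]


/-- **The residual dévissage, lower count: `#R_𝔭^Σ(K_∞, A) · #R_𝔭^Σ(K_∞, C) ≤ #R_𝔭^Σ(K_∞, B) · #C`** whenever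
`q_* : R(B) → R(C)` is SURJECTIVE (hypothesis `hsurjR` — the residual shadow of the global-to-local
surjectivity of Pollack–Weston A.2 / Greenberg; nothing else: no condition at `𝔭`, no (U)), for a
`Γ_K`-equivariant complex `A —j→ B —q→ C` with `j` injective, `ker q ⊆ im j`, `q ∘ j = 0`, `C` finite and
`R(B)` finite. Proof: `j_*` maps `R(A)` into `ker(q_*|R(B))` with kernel of order `≤ #C` (§1), and
`#R(B) = #ker(q_*|R(B)) · #R(C)`. This is the direction the wall of crux 4 consumes (a LOWER bound for
`λ(𝔛^S_f)`); the hypothesis is exactly what the printed proofs take from [PW11, Prop. A.2].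
[cite: KellerYin2024, Thm. 1.4.1, Rem. 1.4.2 (arXiv:2402.12781v2 §1.4)]
[cite: GreenbergVatsal2000, §2 Prop. (2.1) and pp. 25–26] [cite: PollackWeston2011, App. A Prop. A.2] -/
theorem natCard_mul_natCard_le_of_surjective [Finite C] (j : A →+ B)
    (hj' : ∀ (σ : absoluteGaloisGroup K) (a : A), j (σ • a) = σ • j a) (hinj : Function.Injective j)
    (q : B →+ C) (hq' : ∀ (σ : absoluteGaloisGroup K) (b : B), q (σ • b) = σ • q b)
    (hqj : ∀ a : A, q (j a) = 0) (hexact : ∀ b : B, q b = 0 → ∃ a : A, j a = b)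
    (hB : (datumStrictSelmer κ.kerSubgroup B p (AcSelmer.bdpData B p 𝔭) S₀ :
      Set (Literature.NumberTheory.EllipticCurves.subgroupH1 κ.kerSubgroup B)).Finite)
    (hsurjR : ∀ z ∈ datumStrictSelmer κ.kerSubgroup C p (AcSelmer.bdpData C p 𝔭) S₀,
      ∃ y ∈ datumStrictSelmer κ.kerSubgroup B p (AcSelmer.bdpData B p 𝔭) S₀,
        resH1Hom (ContinuousMonoidHom.id κ.kerSubgroup) q (fun _ b ↦ hq' _ b) y = z) :
    Nat.card (datumStrictSelmer κ.kerSubgroup A p (AcSelmer.bdpData A p 𝔭) S₀) *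
        Nat.card (datumStrictSelmer κ.kerSubgroup C p (AcSelmer.bdpData C p 𝔭) S₀) ≤
      Nat.card (datumStrictSelmer κ.kerSubgroup B p (AcSelmer.bdpData B p 𝔭) S₀) * Nat.card C := by
  let H := κ.kerSubgroup
  let jH := resH1Hom (ContinuousMonoidHom.id H) j (fun _ a ↦ hj' _ a)
  let qH := resH1Hom (ContinuousMonoidHom.id H) q (fun _ b ↦ hq' _ b)
  let RA := datumStrictSelmer H A p (AcSelmer.bdpData A p 𝔭) S₀
  let RB := datumStrictSelmer H B p (AcSelmer.bdpData B p 𝔭) S₀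
  let RC := datumStrictSelmer H C p (AcSelmer.bdpData C p 𝔭) S₀
  haveI hBfin : Finite RB := hB.to_subtype
  -- `q_*|_{R(B)}` is onto `R(C)`
  let g' : RB →+ Literature.NumberTheory.EllipticCurves.subgroupH1 H C := qH.comp RB.subtype
  have hcardB : Nat.card RB = Nat.card g'.ker * Nat.card g'.range :=
    ResidualDevissageCount.natCard_eq_card_ker_mul_card_range g'
  have hrange : g'.range = RC := by
    ext z
    constructor
    · rintro ⟨r, rfl⟩
      exact resH1Hom_id_mem_residualSelmer H p 𝔭 S₀ q hq' (fun _ b ↦ hq' _ b) r.2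
    · intro hz
      obtain ⟨y, hy, e⟩ := hsurjR z hz
      exact ⟨⟨y, hy⟩, e⟩
  have hrangeC : Nat.card g'.range = Nat.card RC := by rw [hrange]
  -- `j_*|_{R(A)}`: kernel of order `≤ #C`, range inside `ker(q_*|R(B))`
  let h : RA →+ Literature.NumberTheory.EllipticCurves.subgroupH1 H B := jH.comp RA.subtype
  have hcardA : Nat.card RA = Nat.card h.ker * Nat.card h.range :=
    ResidualDevissageCount.natCard_eq_card_ker_mul_card_range h
  haveI : Finite {y : Literature.NumberTheory.EllipticCurves.subgroupH1 H A // jH y = 0} :=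
    (finite_ker_resH1Hom_id_of_finite (G := H) j (fun _ a ↦ hj' _ a) hinj q hexact).to_subtype
  have hkerC : Nat.card h.ker ≤ Nat.card C := by
    refine le_trans ?_ (natCard_ker_resH1Hom_id_le (G := H) j (fun _ a ↦ hj' _ a) hinj q hexact)
    refine Nat.card_le_card_of_injective (fun r ↦ (⟨((r : RA) :
      Literature.NumberTheory.EllipticCurves.subgroupH1 H A), (AddMonoidHom.mem_ker).mp r.2⟩ :
        {y : Literature.NumberTheory.EllipticCurves.subgroupH1 H A // jH y = 0})) fun r r' e ↦ ?_
    dsimp only at e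
    exact Subtype.ext (Subtype.ext (Subtype.mk.inj e))
  have hrangeB : ∀ z ∈ h.range, z ∈ RB ∧ qH z = 0 := by
    rintro _ ⟨r, rfl⟩
    exact ⟨resH1Hom_id_mem_residualSelmer H p 𝔭 S₀ j hj' (fun _ a ↦ hj' _ a) r.2,
      resH1Hom_id_comp_eq_zero (G := H) j (fun _ a ↦ hj' _ a) q (fun _ b ↦ hq' _ b) hqj _⟩
  have hrange_le : Nat.card h.range ≤ Nat.card g'.ker := by
    refine Nat.card_le_card_of_injective (fun z ↦ (⟨⟨(z : Literature.NumberTheory.EllipticCurves.subgroupH1 H B),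
      (hrangeB _ z.2).1⟩, (AddMonoidHom.mem_ker).mpr (hrangeB _ z.2).2⟩ : g'.ker)) fun z z' e ↦ ?_
    dsimp only at e
    exact Subtype.ext (Subtype.mk.inj (Subtype.mk.inj e))
  -- assemble
  calc Nat.card RA * Nat.card RC = Nat.card h.ker * Nat.card h.range * Nat.card RC := by rw [hcardA]
    _ ≤ Nat.card C * Nat.card g'.ker * Nat.card g'.range := by
        rw [hrangeC]
        exact Nat.mul_le_mul_right _ (Nat.mul_le_mul hkerC hrange_le)
    _ = Nat.card RB * Nat.card C := by rw [hcardB]; ring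


end Residual

/-! ### §5 The elliptic-curve assembly along a `Γ_K`-stable subgroup `Φ ≤ E[p]` -/

section Curve

variable {K : Type} [Field K] [NumberField K] (W : WeierstrassCurve K) [W.IsElliptic] {p : ℕ}
  [Fact p.Prime] (κ : ZpExtension K p)

/-- `E[p]/Φ` is finite (indeed `#E[p] = p²`). [cite: SilvermanAEC2009, Cor. III.6.4(b)] -/
theorem finite_quot_stableSubgroup (Φ : StableSubgroup (absoluteGaloisGroup K) (W.geomTorsion (p : ℤ))) :
    Finite Φ.Quot := by
  have hpp : p.Prime := Fact.out
  have hEp : Nat.card (W.geomTorsion ((p : ℕ) : ℤ)) = p ^ 2 := W.natCard_geomTorsion_prime_eq_sq hpp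
  refine Nat.finite_of_card_ne_zero fun h0 ↦ ?_
  have h := Φ.natCard_eq_mul
  rw [hEp, h0] at h
  exact pow_ne_zero 2 hpp.ne_zero (by simpa using h)

/-- **Upper count for `E[p]` along a stable subgroup: `#R_𝔭^Σ(K_∞, E[p]) ≤ #R_𝔭^Σ(K_∞, Φ) · #R_𝔭^Σ(K_∞, E[p]/Φ) ·
#(E[p]/Φ)^{p^c}`.** For an elliptic curve `E = W/K`, ANY `ℤ_p`-extension `κ`, a place `𝔭 ∋ p` with `p^c` elements
`τ i` controlling the strict condition above `𝔭` (`hreps`; Brink when `D_𝔭 ⊄ ker κ`), `Σ ⊇` the bad places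
prime to `p` ((U) by Néron–Ogg–Shafarevich: `I_v` acts trivially on `E[p]`), and ANY `Γ_K`-stable `Φ ≤ E[p]` with
`R(Φ)`, `R(E[p]/Φ)` finite. Unconditional; no hypothesis at `𝔭` on `E[p]/Φ` (anomalous / split-multiplicative
allowed). For a rational LINE at an Eisenstein prime `#(E[p]/Φ) = p`: `d R(E[p]) ≤ d R(φ) + d R(ψ) + p^c`.
[cite: KellerYin2024, Thm. 1.4.1 (arXiv:2402.12781v2 §1.4)] [cite: CastellaGrossiLeeSkinner2022, Prop. 17 (arXiv:2008.02571 §1.4)]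
[cite: SilvermanAEC2009, Prop. VII.4.1(a)] -/
theorem natCard_residualSelmer_torsion_le_of_stableSubgroup
    {𝔭 : HeightOneSpectrum (𝓞 K)} (h𝔭 : ((p : ℕ) : 𝓞 K) ∈ 𝔭.asIdeal) {S : Set (HeightOneSpectrum (𝓞 K))}
    (hS : ∀ v : HeightOneSpectrum (𝓞 K), v ∉ S → ((p : ℕ) : 𝓞 K) ∉ v.asIdeal → W.HasGoodReductionAt v)
    (Φ : StableSubgroup (absoluteGaloisGroup K) (W.geomTorsion (p : ℤ)))
    (c : ℕ) (τ : ℕ → absoluteGaloisGroup K)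
    (hreps : ∀ x : Literature.NumberTheory.EllipticCurves.subgroupH1 κ.kerSubgroup Φ.Sub,
      (∀ i, i < p ^ c → resOfLe Φ.Sub (inf_le_left : κ.kerSubgroup ⊓ decomp 𝔭 ≤ κ.kerSubgroup)
        (conjH1 κ.kerSubgroup Φ.Sub (τ i) x) = 0) →
      ∀ σ : absoluteGaloisGroup K, resOfLe Φ.Sub (inf_le_left : κ.kerSubgroup ⊓ decomp 𝔭 ≤ κ.kerSubgroup)
        (conjH1 κ.kerSubgroup Φ.Sub σ x) = 0)
    (hΦ : (datumStrictSelmer κ.kerSubgroup Φ.Sub p (AcSelmer.bdpData Φ.Sub p 𝔭) S :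
      Set (Literature.NumberTheory.EllipticCurves.subgroupH1 κ.kerSubgroup Φ.Sub)).Finite)
    (hΨ : (datumStrictSelmer κ.kerSubgroup Φ.Quot p (AcSelmer.bdpData Φ.Quot p 𝔭) S :
      Set (Literature.NumberTheory.EllipticCurves.subgroupH1 κ.kerSubgroup Φ.Quot)).Finite) :
    Nat.card (datumStrictSelmer κ.kerSubgroup (W.geomTorsion (p : ℤ)) p (AcSelmer.bdpData _ p 𝔭) S) ≤
      Nat.card (datumStrictSelmer κ.kerSubgroup Φ.Sub p (AcSelmer.bdpData Φ.Sub p 𝔭) S) *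
        Nat.card (datumStrictSelmer κ.kerSubgroup Φ.Quot p (AcSelmer.bdpData Φ.Quot p 𝔭) S) *
          Nat.card Φ.Quot ^ (p ^ c) := by
  haveI : Finite Φ.Quot := finite_quot_stableSubgroup W Φ
  have hcont : ∀ b : W.geomTorsion (p : ℤ), Continuous fun g : absoluteGaloisGroup K ↦ g • b :=
    continuous_smul_geomTorsion W (p : ℤ)
  refine natCard_datumStrictSelmer_le_of_devissage κ 𝔭 S h𝔭 Φ.incl Φ.incl_smul Φ.incl_injective Φ.proj
    Φ.proj_smul Φ.proj_surjective
    (fun b hb ↦ AddMonoidHom.mem_range.mp (Φ.mem_range_incl_of_proj_eq_zero b hb)) hcont ?_ c τ hreps hΦ hΨ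
  intro v hvS hvp
  exact resH1Hom_id_injective_of_smul_eq (G := ↥(inertiaIn κ.kerSubgroup v)) Φ.incl (fun _ a ↦ Φ.incl_smul _ a)
    Φ.incl_injective (fun τ' b ↦ CumulativeHeegnerInclusionAtThreeStubB1DevissageCurve.inertiaIn_smul_geomTorsion_eq
      W p κ.kerSubgroup (hS v hvS hvp) hvp τ' b)

/-- **The same with the representatives supplied by Brink's finite decomposition** (`D_𝔭 ⊄ ker κ`, e.g. every
place above `p` in the anticyclotomic `ℤ_p`-extension of an imaginary quadratic field): `∃ c` with
`#R(E[p]) ≤ #R(Φ) · #R(E[p]/Φ) · #(E[p]/Φ)^{p^c}` (tree `forall_resOfLe_conjH1_eq_zero_of_reps`).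
[cite: Brink2007, Cor. 1] [cite: KellerYin2024, Thm. 1.4.1 (arXiv:2402.12781v2 §1.4)] -/
theorem exists_natCard_residualSelmer_torsion_le_of_stableSubgroup
    {𝔭 : HeightOneSpectrum (𝓞 K)} (h𝔭 : ((p : ℕ) : 𝓞 K) ∈ 𝔭.asIdeal) (h𝔭dec : ¬ (decomp 𝔭 ≤ κ.kerSubgroup))
    {S : Set (HeightOneSpectrum (𝓞 K))}
    (hS : ∀ v : HeightOneSpectrum (𝓞 K), v ∉ S → ((p : ℕ) : 𝓞 K) ∉ v.asIdeal → W.HasGoodReductionAt v)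
    (Φ : StableSubgroup (absoluteGaloisGroup K) (W.geomTorsion (p : ℤ)))
    (hΦ : (datumStrictSelmer κ.kerSubgroup Φ.Sub p (AcSelmer.bdpData Φ.Sub p 𝔭) S :
      Set (Literature.NumberTheory.EllipticCurves.subgroupH1 κ.kerSubgroup Φ.Sub)).Finite)
    (hΨ : (datumStrictSelmer κ.kerSubgroup Φ.Quot p (AcSelmer.bdpData Φ.Quot p 𝔭) S :
      Set (Literature.NumberTheory.EllipticCurves.subgroupH1 κ.kerSubgroup Φ.Quot)).Finite) :
    ∃ c : ℕ, Nat.card (datumStrictSelmer κ.kerSubgroup (W.geomTorsion (p : ℤ)) p (AcSelmer.bdpData _ p 𝔭) S) ≤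
      Nat.card (datumStrictSelmer κ.kerSubgroup Φ.Sub p (AcSelmer.bdpData Φ.Sub p 𝔭) S) *
        Nat.card (datumStrictSelmer κ.kerSubgroup Φ.Quot p (AcSelmer.bdpData Φ.Quot p 𝔭) S) *
          Nat.card Φ.Quot ^ (p ^ c) := by
  obtain ⟨c, hc⟩ := forall_resOfLe_conjH1_eq_zero_of_reps (M := Φ.Sub) (κ := κ) 𝔭 h𝔭dec
  have hτex : ∀ i : ℕ, ∃ τ : absoluteGaloisGroup K, κ τ = Multiplicative.ofAdd ((i : ℕ) : ℤ_[p]) :=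
    fun i ↦ κ.surjective _
  choose τ hτ using hτex
  exact ⟨c, natCard_residualSelmer_torsion_le_of_stableSubgroup W κ h𝔭 hS Φ c τ (hc τ hτ) hΦ hΨ⟩

/-- **Lower count for `E[p]` along a stable subgroup, modulo the surjectivity of
`R_𝔭^Σ(K_∞, E[p]) → R_𝔭^Σ(K_∞, E[p]/Φ)`: `#R(Φ) · #R(E[p]/Φ) ≤ #R(E[p]) · #(E[p]/Φ)`.** Any number field, any
`ℤ_p`-extension, any `𝔭`, any `Σ`, any stable `Φ`; `R(E[p])` finite. For a rational LINE at an Eisenstein prime: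
`d R(φ) + d R(ψ) ≤ d R(E[p]) + 1` — Keller–Yin's count with its `+1`, GIVEN the surjectivity.
[cite: KellerYin2024, Thm. 1.4.1 and Rem. 1.4.2 (arXiv:2402.12781v2 §1.4)] [cite: PollackWeston2011, App. A Prop. A.2] -/
theorem natCard_mul_le_of_stableSubgroup_of_surjective
    (𝔭 : HeightOneSpectrum (𝓞 K)) (S : Set (HeightOneSpectrum (𝓞 K)))
    (Φ : StableSubgroup (absoluteGaloisGroup K) (W.geomTorsion (p : ℤ)))
    (hE : (datumStrictSelmer κ.kerSubgroup (W.geomTorsion (p : ℤ)) p (AcSelmer.bdpData _ p 𝔭) S :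
      Set (Literature.NumberTheory.EllipticCurves.subgroupH1 κ.kerSubgroup (W.geomTorsion (p : ℤ)))).Finite)
    (hsurjR : ∀ z ∈ datumStrictSelmer κ.kerSubgroup Φ.Quot p (AcSelmer.bdpData Φ.Quot p 𝔭) S,
      ∃ y ∈ datumStrictSelmer κ.kerSubgroup (W.geomTorsion (p : ℤ)) p (AcSelmer.bdpData _ p 𝔭) S,
        resH1Hom (ContinuousMonoidHom.id κ.kerSubgroup) Φ.proj (fun _ b ↦ Φ.proj_smul _ b) y = z) :
    Nat.card (datumStrictSelmer κ.kerSubgroup Φ.Sub p (AcSelmer.bdpData Φ.Sub p 𝔭) S) *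
        Nat.card (datumStrictSelmer κ.kerSubgroup Φ.Quot p (AcSelmer.bdpData Φ.Quot p 𝔭) S) ≤
      Nat.card (datumStrictSelmer κ.kerSubgroup (W.geomTorsion (p : ℤ)) p (AcSelmer.bdpData _ p 𝔭) S) *
        Nat.card Φ.Quot := by
  haveI : Finite Φ.Quot := finite_quot_stableSubgroup W Φ
  exact natCard_mul_natCard_le_of_surjective κ 𝔭 S Φ.incl Φ.incl_smul Φ.incl_injective Φ.proj Φ.proj_smul
    Φ.proj_incl (fun b hb ↦ AddMonoidHom.mem_range.mp (Φ.mem_range_incl_of_proj_eq_zero b hb)) hE hsurjR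

/-! ### §6 The same in the currency of `Sel_𝔭^Σ(K_∞, E[p^∞])[p]` (the tree's Kummer comparison) -/

/-- **`#Sel_𝔭^Σ(K_∞, E[p^∞])[p] ≤ #R(Φ) · #R(E[p]/Φ) · #(E[p]/Φ)^{p^c}`** — §5's upper count read through the
tree's exact Kummer comparison `#R_𝔭^Σ(K_∞, E[p]) = #Sel_𝔭^Σ(K_∞, E[p^∞])[p]`
(`UniversalToricDescentResidualSelmerExact.natCard_residualSelmer_eq_natCard_selmerAc_pTorsion`, `p` odd, (L):
no `p`-torsion of `E[p^∞]` fixed by `H ⊓ D_𝔭`). `Sel_𝔭^Σ(K_∞, E[p^∞])` is Castella's group whose dual is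
`AcSelmer.XAc` = Keller–Yin's `𝔛^S_f` (crux-4 dictionary), so this bounds `#(𝔛^S_f / p)` by the residual counts
of the two characters. [cite: GreenbergVatsal2000, §2 Prop. (2.8)] [cite: KellerYin2024, Thm. 1.4.1 (arXiv:2402.12781v2 §1.4)] -/
theorem natCard_selmerAc_pTorsion_le_of_stableSubgroup (hp : p ≠ 2)
    {𝔭 : HeightOneSpectrum (𝓞 K)} (h𝔭 : ((p : ℕ) : 𝓞 K) ∈ 𝔭.asIdeal) {S : Set (HeightOneSpectrum (𝓞 K))}
    (hS : ∀ v : HeightOneSpectrum (𝓞 K), v ∉ S → ((p : ℕ) : 𝓞 K) ∉ v.asIdeal → W.HasGoodReductionAt v)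
    (hL : ∀ m : W.geomPrimaryTorsion p,
      (∀ σ ∈ κ.kerSubgroup ⊓ decomp 𝔭, σ • m = m) → p • m = 0 → m = 0)
    (Φ : StableSubgroup (absoluteGaloisGroup K) (W.geomTorsion (p : ℤ)))
    (c : ℕ) (τ : ℕ → absoluteGaloisGroup K)
    (hreps : ∀ x : Literature.NumberTheory.EllipticCurves.subgroupH1 κ.kerSubgroup Φ.Sub,
      (∀ i, i < p ^ c → resOfLe Φ.Sub (inf_le_left : κ.kerSubgroup ⊓ decomp 𝔭 ≤ κ.kerSubgroup)
        (conjH1 κ.kerSubgroup Φ.Sub (τ i) x) = 0) →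
      ∀ σ : absoluteGaloisGroup K, resOfLe Φ.Sub (inf_le_left : κ.kerSubgroup ⊓ decomp 𝔭 ≤ κ.kerSubgroup)
        (conjH1 κ.kerSubgroup Φ.Sub σ x) = 0)
    (hΦ : (datumStrictSelmer κ.kerSubgroup Φ.Sub p (AcSelmer.bdpData Φ.Sub p 𝔭) S :
      Set (Literature.NumberTheory.EllipticCurves.subgroupH1 κ.kerSubgroup Φ.Sub)).Finite)
    (hΨ : (datumStrictSelmer κ.kerSubgroup Φ.Quot p (AcSelmer.bdpData Φ.Quot p 𝔭) S :
      Set (Literature.NumberTheory.EllipticCurves.subgroupH1 κ.kerSubgroup Φ.Quot)).Finite) :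
    Nat.card {s : selmerAc W p κ 𝔭 S // p • s = 0} ≤
      Nat.card (datumStrictSelmer κ.kerSubgroup Φ.Sub p (AcSelmer.bdpData Φ.Sub p 𝔭) S) *
        Nat.card (datumStrictSelmer κ.kerSubgroup Φ.Quot p (AcSelmer.bdpData Φ.Quot p 𝔭) S) *
          Nat.card Φ.Quot ^ (p ^ c) := by
  rw [← UniversalToricDescentResidualSelmerExact.natCard_residualSelmer_eq_natCard_selmerAc_pTorsion W κ hp
    h𝔭 hS hL]
  exact natCard_residualSelmer_torsion_le_of_stableSubgroup W κ h𝔭 hS Φ c τ hreps hΦ hΨ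

/-- **`#R(Φ) · #R(E[p]/Φ) ≤ #Sel_𝔭^Σ(K_∞, E[p^∞])[p] · #(E[p]/Φ)`** given the surjectivity of
`R(E[p]) → R(E[p]/Φ)` — §5's lower count through the same Kummer comparison (`p` odd, (L)).
[cite: GreenbergVatsal2000, §2 Prop. (2.8)] [cite: KellerYin2024, Thm. 1.4.1 and Rem. 1.4.2 (arXiv:2402.12781v2 §1.4)] -/
theorem natCard_mul_le_natCard_selmerAc_pTorsion_of_surjective (hp : p ≠ 2)
    {𝔭 : HeightOneSpectrum (𝓞 K)} (h𝔭 : ((p : ℕ) : 𝓞 K) ∈ 𝔭.asIdeal) {S : Set (HeightOneSpectrum (𝓞 K))}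
    (hS : ∀ v : HeightOneSpectrum (𝓞 K), v ∉ S → ((p : ℕ) : 𝓞 K) ∉ v.asIdeal → W.HasGoodReductionAt v)
    (hL : ∀ m : W.geomPrimaryTorsion p,
      (∀ σ ∈ κ.kerSubgroup ⊓ decomp 𝔭, σ • m = m) → p • m = 0 → m = 0)
    (Φ : StableSubgroup (absoluteGaloisGroup K) (W.geomTorsion (p : ℤ)))
    (hE : (datumStrictSelmer κ.kerSubgroup (W.geomTorsion (p : ℤ)) p (AcSelmer.bdpData _ p 𝔭) S :
      Set (Literature.NumberTheory.EllipticCurves.subgroupH1 κ.kerSubgroup (W.geomTorsion (p : ℤ)))).Finite)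
    (hsurjR : ∀ z ∈ datumStrictSelmer κ.kerSubgroup Φ.Quot p (AcSelmer.bdpData Φ.Quot p 𝔭) S,
      ∃ y ∈ datumStrictSelmer κ.kerSubgroup (W.geomTorsion (p : ℤ)) p (AcSelmer.bdpData _ p 𝔭) S,
        resH1Hom (ContinuousMonoidHom.id κ.kerSubgroup) Φ.proj (fun _ b ↦ Φ.proj_smul _ b) y = z) :
    Nat.card (datumStrictSelmer κ.kerSubgroup Φ.Sub p (AcSelmer.bdpData Φ.Sub p 𝔭) S) *
        Nat.card (datumStrictSelmer κ.kerSubgroup Φ.Quot p (AcSelmer.bdpData Φ.Quot p 𝔭) S) ≤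
      Nat.card {s : selmerAc W p κ 𝔭 S // p • s = 0} * Nat.card Φ.Quot := by
  rw [← UniversalToricDescentResidualSelmerExact.natCard_residualSelmer_eq_natCard_selmerAc_pTorsion W κ hp
    h𝔭 hS hL]
  exact natCard_mul_le_of_stableSubgroup_of_surjective W κ 𝔭 S Φ hE hsurjR

end Curve

end Summit.BirchSwinnertonDyer.BirchSwinnertonDyer.Theorems.ResidualDevissageCountLower

end
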